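import Mathlib
import Literature.MathematicalPhysics.KineticTheory.FouriersLaw
import Literature.MathematicalPhysics.KineticTheory.InfiniteChainDynamics
import Literature.MathematicalPhysics.KineticTheory.InfiniteChainInvariantStates

/-!
# Typed companion of `STRATEGY-CENSUS-s2-addendum-CSM.md` (crux stmt-AtomisticToContinuum-11749, `ConductanceLowerBound`)

crux-strategist s2, instance CSM (twin-30b7), 2026-08-17.  Two kernel-checked facts behind addendum entries A1 and A2.

* §1 (A1) **Inverse-moment floors lose exactly a square.**  In the contact currency of route ContactStieltjesMeasure
  (`G_N(γ) = γ ∫ dμ̂_N(s)/(γ²+s²)`), for every finitely-atomic non-negative measure `Σ_k w_k δ_{s_k}` on `(0,∞)` and `γ > 0`,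
  Cauchy–Schwarz gives `m₋₂² ≤ (Σ w/(γ²+s²)) · (m₋₂ + γ² m₋₄)`, i.e. `G ≥ γ m₋₂²/(m₋₂ + γ² m₋₄)` (`stieltjes_sq_loss`,
  `stieltjes_floor_of_inverse_moments`), and the two-atom measure `(4N²)⁻¹ δ_{1/N} + m δ_N` has `m₋₂ = ¼ + m/N²` while
  `Σ w/(1+s²) ≤ (¼ + m)/N²` (`twoAtom_inverseMoment`, `twoAtom_transmission_le`): two inverse moments certify `N⁻²`, never `N⁻¹`.
* §2 (A2) `NoFrozenWall` — the rate-free, even-sector Liouville-type statement ("no stationary microscopic domain wall between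
  two temperatures") TYPED over the tree's infinite-chain declarations, recorded so that Liouville-family planners can cite the
  exact statement the addendum says is NOT enough for stmt-11749 (the residual `NoHomogeneousSubdiffusion` is the crux's rate).
  A definition only; nothing is claimed about it here.
-/

noncomputable section

open MeasureTheory Filter Topology Finset
open scoped BigOperators

namespace Summit.AtomisticToContinuum.FouriersLaw.Cruxes.ConductanceLowerBound.StrategyCensusS2CSM

/-! ## §1 Inverse-moment floors lose a square (A1) -/

/-- **Cauchy–Schwarz square loss.** For non-negative weights `w_k` at positive scales `s_k` and `γ > 0`:
`(Σ w_k/s_k²)² ≤ (Σ w_k/(γ²+s_k²)) · (Σ w_k (γ²+s_k²)/s_k⁴)`. -/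
theorem stieltjes_sq_loss {ι : Type*} (S : Finset ι) (w s : ι → ℝ)
    (hw : ∀ i ∈ S, 0 ≤ w i) (hs : ∀ i ∈ S, 0 < s i) (γ : ℝ) :
    (∑ i ∈ S, w i / (s i) ^ 2) ^ 2
      ≤ (∑ i ∈ S, w i / (γ ^ 2 + (s i) ^ 2)) * (∑ i ∈ S, w i * (γ ^ 2 + (s i) ^ 2) / (s i) ^ 4) := by
  -- f_i := √(w_i/(γ²+s_i²)),  g_i := √(w_i (γ²+s_i²)) / s_i²,  f_i g_i = w_i / s_i²
  set f : ι → ℝ := fun i => Real.sqrt (w i / (γ ^ 2 + (s i) ^ 2)) with hf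
  set g : ι → ℝ := fun i => Real.sqrt (w i * (γ ^ 2 + (s i) ^ 2)) / (s i) ^ 2 with hg
  have hden : ∀ i ∈ S, 0 < γ ^ 2 + (s i) ^ 2 := fun i hi => by
    have := hs i hi; positivity
  have hfg : ∀ i ∈ S, f i * g i = w i / (s i) ^ 2 := by
    intro i hi
    have hd := hden i hi
    have hsi := hs i hi
    have hwi := hw i hi
    simp only [hf, hg]
    rw [← mul_div_assoc, ← Real.sqrt_mul (div_nonneg hwi hd.le)]
    have : w i / (γ ^ 2 + s i ^ 2) * (w i * (γ ^ 2 + s i ^ 2)) = (w i) ^ 2 := by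
      field_simp
    rw [this, Real.sqrt_sq hwi]
  have hff : ∀ i ∈ S, f i ^ 2 = w i / (γ ^ 2 + (s i) ^ 2) := by
    intro i hi
    simp only [hf]
    rw [Real.sq_sqrt (div_nonneg (hw i hi) (hden i hi).le)]
  have hgg : ∀ i ∈ S, g i ^ 2 = w i * (γ ^ 2 + (s i) ^ 2) / (s i) ^ 4 := by
    intro i hi
    simp only [hg]
    rw [div_pow, Real.sq_sqrt (mul_nonneg (hw i hi) (hden i hi).le)]
    ring
  calc (∑ i ∈ S, w i / (s i) ^ 2) ^ 2
      = (∑ i ∈ S, f i * g i) ^ 2 := by rw [Finset.sum_congr rfl hfg]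
    _ ≤ (∑ i ∈ S, f i ^ 2) * (∑ i ∈ S, g i ^ 2) := Finset.sum_mul_sq_le_sq_mul_sq S f g
    _ = (∑ i ∈ S, w i / (γ ^ 2 + (s i) ^ 2)) * (∑ i ∈ S, w i * (γ ^ 2 + (s i) ^ 2) / (s i) ^ 4) := by
        rw [Finset.sum_congr rfl hff, Finset.sum_congr rfl hgg]

/-- **The inverse-moment floor** in the form used in A1: with `m₋₂ := Σ w/s²`, `m₋₄ := Σ w/s⁴` and the transmission
integral `G/γ := Σ w/(γ²+s²)`, one has `m₋₂² ≤ (G/γ) · (m₋₂ + γ² m₋₄)` — hence `G ≥ γ m₋₂²/(m₋₂ + γ² m₋₄)` whenever the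
denominator is positive.  With the diffusive truth `m₋₂ ≍ 1`, `m₋₄ ≍ N²` this certifies only `G ≳ N⁻²`. -/
theorem stieltjes_floor_of_inverse_moments {ι : Type*} (S : Finset ι) (w s : ι → ℝ)
    (hw : ∀ i ∈ S, 0 ≤ w i) (hs : ∀ i ∈ S, 0 < s i) (γ : ℝ) :
    (∑ i ∈ S, w i / (s i) ^ 2) ^ 2
      ≤ (∑ i ∈ S, w i / (γ ^ 2 + (s i) ^ 2)) *
          ((∑ i ∈ S, w i / (s i) ^ 2) + γ ^ 2 * ∑ i ∈ S, w i / (s i) ^ 4) := by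
  have h := stieltjes_sq_loss S w s hw hs γ
  have hsplit : (∑ i ∈ S, w i * (γ ^ 2 + (s i) ^ 2) / (s i) ^ 4)
      = (∑ i ∈ S, w i / (s i) ^ 2) + γ ^ 2 * ∑ i ∈ S, w i / (s i) ^ 4 := by
    rw [Finset.mul_sum, ← Finset.sum_add_distrib]
    refine Finset.sum_congr rfl fun i hi => ?_
    have hsi : s i ≠ 0 := (hs i hi).ne'
    field_simp
    ring
  simpa [hsplit] using h

/-- **The two-atom extremiser, inverse second moment.** Weights `(4N²)⁻¹` at scale `1/N` and `m` at scale `N`: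
`m₋₂ = ¼ + m/N²` (so it respects `m₋₂ ≤ ½`, i.e. `G ≤ γ/2`, as soon as `N² ≥ 4m`). -/
theorem twoAtom_inverseMoment (N m : ℝ) (hN : 0 < N) :
    (1 / (4 * N ^ 2)) / (1 / N) ^ 2 + m / N ^ 2 = 1 / 4 + m / N ^ 2 := by
  have hN' : N ≠ 0 := hN.ne'
  field_simp

/-- **The two-atom extremiser, transmission at `γ = 1`.** The same measure has `Σ w/(1+s²) ≤ (¼ + m)/N²`: every constraint of
inverse-moment type is met while the conductance sits at the INSULATING scale `N⁻²`. -/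
theorem twoAtom_transmission_le (N m : ℝ) (hN : 1 ≤ N) (hm : 0 ≤ m) :
    (1 / (4 * N ^ 2)) / (1 + (1 / N) ^ 2) + m / (1 + N ^ 2) ≤ (1 / 4 + m) / N ^ 2 := by
  have hN0 : 0 < N := by linarith
  have h1 : (1 / (4 * N ^ 2)) / (1 + (1 / N) ^ 2) ≤ 1 / (4 * N ^ 2) := by
    apply div_le_self (by positivity)
    have : 0 ≤ (1 / N) ^ 2 := by positivity
    linarith
  have h2 : m / (1 + N ^ 2) ≤ m / N ^ 2 := by
    apply div_le_div_of_nonneg_left hm (by positivity)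
    linarith
  have h3 : 1 / (4 * N ^ 2) + m / N ^ 2 = (1 / 4 + m) / N ^ 2 := by
    have : N ≠ 0 := hN0.ne'
    field_simp
  linarith [h1, h2, h3.le, h3.ge]

/-! ## §2 The rate-free even-sector statement of A2 (definition only) -/

open Literature.MathematicalPhysics.KineticTheory.HeatConduction in
/-- **NoFrozenWall** (A2): for the infinite pinned anharmonic chain (`ω₂, lam, β > 0`, `γ` inert), every time-invariant probability
measure on `ChainConfig` with site-uniform polynomial moments whose kinetic-temperature profile `x ↦ ∫ (σ x).2² dν` has limits `T₁` at
`−∞` and `T₂` at `+∞` satisfies `T₁ = T₂` — no stationary microscopic domain wall between two temperatures.  Rate-free; in the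
`MacroErgodicityBarrier` class (a consequence of any Gibbs characterisation of stationary states in a class containing walls).  The
addendum records why it does NOT supply `ConductanceLowerBound`: the residual "no homogeneous subdiffusion" is a rate. -/
def NoFrozenWall : Prop :=
  ∀ ω₂ lam β γ : ℝ, 0 < ω₂ → 0 < lam → 0 < β →
    ∀ ν : Measure ChainConfig, IsProbabilityMeasure ν →
      IsTimeInvariant (pinnedChain ω₂ lam β γ) ν →
      (∀ k : ℕ, ∃ C : ℝ, ∀ x : ℤ, Integrable (fun σ => |(σ x).1| ^ k + |(σ x).2| ^ k) ν ∧
          ∫ σ, (|(σ x).1| ^ k + |(σ x).2| ^ k) ∂ν ≤ C) →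
      ∀ T₁ T₂ : ℝ,
        Tendsto (fun x : ℤ => ∫ σ, ((σ x).2) ^ 2 ∂ν) atBot (𝓝 T₁) →
        Tendsto (fun x : ℤ => ∫ σ, ((σ x).2) ^ 2 ∂ν) atTop (𝓝 T₂) → T₁ = T₂

end Summit.AtomisticToContinuum.FouriersLaw.Cruxes.ConductanceLowerBound.StrategyCensusS2CSM
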